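import Summits.CriticalPhenomena.PercolationContinuityZ3.Theses.PercShatteringRace
import Summits.CriticalPhenomena.PercolationContinuityZ3.Theses.PercHollowCells
import HarnessLib

/-!
# Crux `PercShatteringRace.FreeSusceptibilityPowerSaving` = S(1/2) (stmt-CriticalPhenomena-5786) — BRIDGE from the stronger sibling crux `PercHollowCells.QuantFreeBoxShattering` (stmt-CriticalPhenomena-5837)

Helper file of the line lead c12 (prover-line-stmt-CriticalPhenomena-5786-c12-0),
`--supports stmt-CriticalPhenomena-5786`; it executes recommendation R5 of the crux's STRATEGY-CENSUS v2
(strategist s1, 2026-08-17, `Cruxes/FreeSusceptibilityPowerSaving/STRATEGY-CENSUS.md` §V8; typed there as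
`CensusS1.crux_of_quantFreeBoxShattering`): the two route items bound THE SAME quantity — the free (in-box)
susceptibility of the centre of `Λ_L = box 3 L` at `p_c(ℤ³)`,
`χᶠ_L(p_c) = Σ_{x ∈ Λ_L} P_{p_c}(0 ↔ x inside Λ_L)` — by `C L^{17/8}` (route PercHollowCells, exponent `κ = 7/8`
below the volume) resp. `C R^{5/2}` (route PercShatteringRace, exponent `1/2` below the volume).  Since
`17/8 ≤ 5/2` and `R ≥ 1`, the first implies the second with the same constant (clipped at `0`).

Effect on the ledger: stmt-CriticalPhenomena-5837 becomes a recorded sufficient condition of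
stmt-CriticalPhenomena-5786 (if 5837 is ever proved, 5786 closes through this file).  STATUS OF THE
ANTECEDENT: open, rated `open-problem` in its own route text, for the same reason as S itself (no upper bound
with a power of the scale is known at `p_c(ℤ³)` for any increasing connection quantity; census v2 §V0).  This
file is an interface theorem (exponent monotonicity), not progress on that wall.  No definitions.
-/

noncomputable section

namespace Summit.CriticalPhenomena.PercolationContinuityZ3.Theorems

open MeasureTheory Finset
open Literature.Probability.Percolation Literature.Probability.LatticeModels

/-- **`QuantFreeBoxShattering ⟹ FreeSusceptibilityPowerSaving`** (stmt-CriticalPhenomena-5837 ⟹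
stmt-CriticalPhenomena-5786, census v2 R5; registered stub `stub_quantFreeBoxShatteringBridge` of the crux
item, so that this helper lands `--supports`).  Both decls bound
`Σ_{x ∈ box 3 L} P_{p_c}(0 ↔ x inside box 3 L)` for all `L ≥ 1`: the hypothesis by `C L^{17/8}`, the
conclusion by `C' L^{5/2}`; take `C' = max C 0` and use `L^{17/8} ≤ L^{5/2}` for `1 ≤ L`
(`Real.rpow_le_rpow_of_exponent_le`). -/
theorem stub_quantFreeBoxShatteringBridge :
    Summit.CriticalPhenomena.PercolationContinuityZ3.Theses.PercHollowCells.QuantFreeBoxShattering →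
      Summit.CriticalPhenomena.PercolationContinuityZ3.Theses.PercShatteringRace.FreeSusceptibilityPowerSaving := by
  intro h
  unfold Summit.CriticalPhenomena.PercolationContinuityZ3.Theses.PercShatteringRace.FreeSusceptibilityPowerSaving
  obtain ⟨C, hC⟩ := h
  refine ⟨max C 0, fun R hR => ?_⟩
  have hR1 : (1 : ℝ) ≤ (R : ℝ) := by exact_mod_cast hR
  have hR0 : (0 : ℝ) ≤ (R : ℝ) := Nat.cast_nonneg _
  calc ∑ x ∈ box 3 R, (bondPercolation (zdGraph 3) (criticalProbI 3)).real
          (openConnIn (↑(box 3 R) : Set (Site 3)) 0 x)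
      ≤ C * (R : ℝ) ^ ((17 : ℝ) / 8) := hC R hR
    _ ≤ max C 0 * (R : ℝ) ^ ((17 : ℝ) / 8) :=
        mul_le_mul_of_nonneg_right (le_max_left _ _) (Real.rpow_nonneg hR0 _)
    _ ≤ max C 0 * (R : ℝ) ^ ((5 : ℝ) / 2) :=
        mul_le_mul_of_nonneg_left (Real.rpow_le_rpow_of_exponent_le hR1 (by norm_num))
          (le_max_right _ _)

/-- Descriptive alias of `stub_quantFreeBoxShatteringBridge`:
`QuantFreeBoxShattering → FreeSusceptibilityPowerSaving` (stmt-5837 ⟹ stmt-5786). -/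
theorem freeSusceptibilityPowerSaving_of_quantFreeBoxShattering
    (h : Summit.CriticalPhenomena.PercolationContinuityZ3.Theses.PercHollowCells.QuantFreeBoxShattering) :
    Summit.CriticalPhenomena.PercolationContinuityZ3.Theses.PercShatteringRace.FreeSusceptibilityPowerSaving :=
  stub_quantFreeBoxShatteringBridge h

end Summit.CriticalPhenomena.PercolationContinuityZ3.Theorems

end
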